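/-
Copyright: the b2b-balaban T⁴-continuum CRUX team, row NE7b leaf lineage `t4-ne7b-formalise-leaf-05` (gen 153). Project licence.
-/
import Summits.QuantumFields.BalabanUV.T4Continuum.Spine.NE7b.AdmissibleFloorIMS
import Summits.QuantumFields.BalabanUV.T4Continuum.Spine.NE7b.CurlFormEnergyDomination

/-!
# PRINT's `γ₀` FOR `C*Δ_kC` AS ONE THEOREM OF NAMED LETTERS: `QGQInverse.Coercive (Cᵀ(P − a − 𝒥)C) (c∕640)` from the (h1) letters `r, c₀, τ, q`
# (`p = 16`), the (h2) data (flat floor `c` — PROVED for B6's carrier —, `δ`, `u_s`, `ε`), the (hJ) letters `σ, c₅`, and Theorem E1's smallness conditions —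
# the END junction of `…CurlFormEnergyDomination` ((h1), (hJ)) and `…AdmissibleFloorIMS` ((h2), the value `c∕640`) over `B9SectEKernel.gamma0_assembly`
# (row NE7b, node U5c; residual (R2′) family (2), letter (ℓ1) in B9 Sect. E's matrix currency; ONE junction theorem)

Cell `pub-balaban`, sub-cell `t4`, spine estimate NE7b (`T4WeightBudget.RelWeightBound`; the cell's OWN estimate — NOT PRINTED in [Bałaban 1983–89],
NOT PROVED).  Crux-route work under `Spine/NE7b/`; NOTHING of Bałaban's is asserted; no `def`; zero `sorry`; no `T4Continuum/Support` leaf (FREEZE (0)).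
Imports: this lineage's `…AdmissibleFloorIMS` (p378268 ✓) and `…CurlFormEnergyDomination` (gen 153) — tree `Spine/NE7b` modules.

WHY.  SectE-interface-proof.md §5.8 THEOREM E1: «for `M ≥ M₃(d,L)` and `Mα₀ ≤ a₄(d,L)` (chosen so that `r ≤ ½`, `τc₀ ≤ ⅛`, `c₃c₀ε_F² ≤ 2`, `κ₂ ≤ c∕8`,
`c₄²ε_F² ≤ c∕8`, `θ_J ≤ c∕640`): `C*Δ_kC ≥ γ₀(d,L) := c(d,L)∕640` uniformly in `k`, `Λ`, `U`» — by `gamma0_assembly` with (h1) = Prop. 5.4, (h2) = Prop. 5.6,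
(hJ) = Lemma 5.7.  The two parents kernel-check those three propositions as skeletons of displayed letters; THIS FILE is the one-theorem END that composes
them exactly as §5.8 does, so that the tree holds E1's statement with EVERY analytic input a NAMED hypothesis and every piece of bookkeeping PROVED.

WHAT IS PROVED ([folklore] junction):
* **`coercive_CDeltaC_of_letters`** — data `(K₀, T′, Q, a, H, P, Jm, C, good, F)` of (3.128)∕(3.156)∕(3.158) with `QH = 1`, `(K₀ − T′ + aQᵀQ)H = QᵀP`,
  `C` into `good` and norm-non-decreasing; (h1) letters `r < 1`, `c₀, τ, q ≥ 0`, `Nw, NΩ, Dsq` with (N′), weighted positivity, curl bound, covariant Stokes at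
  `p = 16`, `NΩ ≤ Nw`; (h2) data `K_F, h, ε, u_s, F′_s, F⁰_s, good⁰_s, δ, c` with (iso)(cov)(adm)(pert)(flat) and `⟨x, K_F x⟩ ≤ F x` on `good`; (hJ) letters
  `σ ≥ 0`, `c₅`, `j`, `q_x` with `⟨B, Jm B⟩ = 2Σ j·q(B)`, `|j| ≤ σ`, `Σ|q(B)| ≤ c₅‖B‖²`; E1's smallness `r ≤ ½`, `τc₀ ≤ ⅛`, `qc₀ ≤ 2`, `κ₂ ≤ c∕8` (on CED's
  explicit `κ₂`), `δ ≤ c∕8`, `ε ≤ c∕4`, `2σc₅ ≤ c∕640`, `0 ≤ c` ⊢ `QGQInverse.Coercive (Cᵀ(P − a•1 − Jm)C) (c∕640)`.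
NOT HERE (honest): every letter BY VALUE (the parents' NOT-HERE lists, unchanged); the `(H, P)` invertibility letters (CFF §5 `hessian_lower_of_deltaK` turns
two invertibility hypotheses into `QH = 1`, `SH = QᵀP`); (A3) ∕ (A1c); NC-NE7b-α UNRULED.  BY-NAME EFFECT ON THE WALL: NONE (the wall is (R2)).
NE7b NOT PRINTED ∕ NOT PROVED; spine PROVED 0∕9; rung (B)+1 on ONE finite T⁴ — NOT infinite volume, NOT the mass gap, NOT Clay.
HONEST DEPENDENCY: continuum YM on T⁴ ⇐ BetaPertH ∧ nine spine estimates (0/9 proved); BetaPertH ⇐ (D1) ∧ (D4) ∧ CAP+tail; G-an2-4 gates asym, D1 and NE2/3/4.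
-/

set_option autoImplicit false

noncomputable section

open Matrix Finset
open Literature.MathematicalPhysics.QuantumFieldTheory.Balaban1983to89 (QGQInverse.Coercive)
open Summit.QuantumFields.BalabanUV.T4Continuum.NE7b.AdmissibleFloorIMS (coercive_sandwich_of_ims_value)
open Summit.QuantumFields.BalabanUV.T4Continuum.NE7b.CurlFormEnergyDomination (h1_of_letters kappa1_pos kappa1_le_forty hJ_of_letters)

namespace Summit.QuantumFields.BalabanUV.T4Continuum.NE7b.SectEGammaZeroLetters

variable {n m m' : Type*} [Fintype n] [Fintype m] [DecidableEq m] [Fintype m'] {ι : Type*} [Fintype ι]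

/-- **THEOREM E1 OF THE WRITTEN REPAIR, AS ONE KERNEL STATEMENT OF NAMED LETTERS**: `C*Δ_kC ≥ c∕640` — `B9SectEKernel.gamma0_assembly` ∘
`coercive_sandwich_of_range` with (h1) := `CurlFormEnergyDomination.h1_of_letters` at `p = 16` (`0 < κ₁ ≤ 40` by `kappa1_pos` ∕ `kappa1_le_forty`), (h2) :=
`AdmissibleFloorIMS.admissible_floor` (inside `coercive_sandwich_of_ims_value`), (hJ) := `CurlFormEnergyDomination.hJ_of_letters` (`θ = 2σc₅`), and the value
`c∕640` by `AdmissibleFloorIMS.gamma0_value_ge`. [folklore] -/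
theorem coercive_CDeltaC_of_letters {p X : Type*} [Fintype p] [Fintype X]
    -- print's matrices (3.128), (3.156), (3.158)
    (K₀ T' : Matrix n n ℝ) (Q : Matrix m n ℝ) (a : ℝ) (H : Matrix n m ℝ) (P Jm : Matrix m m ℝ)
    (hQH : Q * H = 1) (hSH : (K₀ - T' + a • (Qᵀ * Q)) * H = Qᵀ * P) (good : (m → ℝ) → Prop) (F : (m → ℝ) → ℝ)
    (C : Matrix m p ℝ) (hgood : ∀ v : p → ℝ, good (C *ᵥ v)) (hC : ∀ v : p → ℝ, v ⬝ᵥ v ≤ (C *ᵥ v) ⬝ᵥ (C *ᵥ v))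
    -- (h1) letters
    {r c₀ τ q : ℝ} (hr : r < 1) (hc₀ : 0 ≤ c₀) (hτ : 0 ≤ τ) (hq : 0 ≤ q)
    (hrel : ∀ A : n → ℝ, A ⬝ᵥ (T' *ᵥ A) ≤ r * (A ⬝ᵥ ((K₀ + a • (Qᵀ * Q)) *ᵥ A)))
    (Nw NΩ Dsq : (n → ℝ) → ℝ) (hNw : ∀ A : n → ℝ, Nw A ≤ c₀ * (A ⬝ᵥ ((K₀ + a • (Qᵀ * Q)) *ᵥ A)))
    (hΩ : ∀ A : n → ℝ, NΩ A ≤ Nw A) (hD : ∀ A : n → ℝ, Dsq A ≤ A ⬝ᵥ (K₀ *ᵥ A) + τ * Nw A)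
    (hF : ∀ A : n → ℝ, F (Q *ᵥ A) ≤ 16 * Dsq A + q * NΩ A)
    -- (h2) data
    (KF : Matrix m m ℝ) (h : ι → m → ℝ) (hpart : ∀ i, ∑ s, h s i ^ 2 = 1) {ε : ℝ} (hε : 0 ≤ ε)
    (hrow : ∀ i, ∑ j, |KF i j| * ∑ s, (h s i - h s j) ^ 2 ≤ ε)
    (hcol : ∀ j, ∑ i, |KF i j| * ∑ s, (h s i - h s j) ^ 2 ≤ ε) {c δ : ℝ}
    (u : ι → (m → ℝ) → (m' → ℝ)) (F' F0 : ι → (m' → ℝ) → ℝ) (good0 : ι → (m' → ℝ) → Prop)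
    (hiso : ∀ s x, good x → u s (h s * x) ⬝ᵥ u s (h s * x) = (h s * x) ⬝ᵥ (h s * x))
    (hcov : ∀ s x, good x → (h s * x) ⬝ᵥ (KF *ᵥ (h s * x)) = F' s (u s (h s * x)))
    (hadm : ∀ s x, good x → good0 s (u s (h s * x)))
    (hpert : ∀ s Y, good0 s Y → F0 s Y / 2 - δ * (Y ⬝ᵥ Y) ≤ F' s Y)
    (hflat : ∀ s Y, good0 s Y → c * (Y ⬝ᵥ Y) ≤ F0 s Y)
    (hFK : ∀ x, good x → x ⬝ᵥ (KF *ᵥ x) ≤ F x)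
    -- (hJ) letters
    {σ c₅ : ℝ} (hσ : 0 ≤ σ) (j : X → ℝ) (qd : X → (m → ℝ) → ℝ)
    (hJm : ∀ B : m → ℝ, B ⬝ᵥ (Jm *ᵥ B) = 2 * ∑ x, j x * qd x B)
    (hj : ∀ x, |j x| ≤ σ) (hqd : ∀ B : m → ℝ, ∑ x, |qd x B| ≤ c₅ * (B ⬝ᵥ B))
    -- Theorem E1's smallness conditions (`M ≥ M₃`, `Mα₀ ≤ a₄`)
    (hc : 0 ≤ c) (hr' : r ≤ 1 / 2) (hτc : τ * c₀ ≤ 1 / 8) (hqc : q * c₀ ≤ 2)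
    (hκ₂ : a * (1 - r)⁻¹ * (16 * (r + τ * c₀) + q * c₀) ≤ c / 8)
    (hδ : δ ≤ c / 8) (hε' : ε ≤ c / 4) (hθ : 2 * σ * c₅ ≤ c / 640) :
    QGQInverse.Coercive (Cᵀ * (P - a • (1 : Matrix m m ℝ) - Jm) * C) (c / 640) :=
  coercive_sandwich_of_ims_value (K₀ - T') Q a H P Jm hQH hSH good F
    (kappa1_pos hr (by norm_num : (0 : ℝ) < 16) (mul_nonneg hτ hc₀) (mul_nonneg hq hc₀))
    (h1_of_letters K₀ T' Q a hr hc₀ hτ (by norm_num : (0 : ℝ) ≤ 16) hq hrel Nw NΩ Dsq hNw hΩ hD F hF)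
    (hJ_of_letters Jm j qd hσ hJm hj hqd)
    KF h hpart hε hrow hcol u F' F0 good0 hiso hcov hadm hpert hflat hFK C hgood hC hc
    (kappa1_le_forty hr' (mul_nonneg hτ hc₀) hτc (mul_nonneg hq hc₀) hqc) hκ₂ hδ hε' hθ

end Summit.QuantumFields.BalabanUV.T4Continuum.NE7b.SectEGammaZeroLetters

end
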